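import Summits.MatrixMultiplication.OmegaCensus.STPPVosperSlackOnePairingSteps
import Summits.MatrixMultiplication.OmegaCensus.STPPVosperSlackOnePairingTables

/-!
# ω-census (abelian STPP census): `{(2,3,5),(3,2,5)} ⊄ ℤ₅₉` by the PAIRING law — window tables with the pairing premise (γ, β) and the word target (kernel computations)

HONEST FRAMING (pub-omega census; verbatim): lottery ticket; floor = certified bounds/negative ranges.
Census STRUCTURE (seat pub-omega-stpp-2 gen 26, 2026-08-28; leaf of the `ℤ₅₉` residual front, stpp-2's by RULING L37-114 (c)), family (b2).  Reading
`(a,b,c) = (2,3,5)` at block `0` of the family `(A, B, C)`, other block `(3,2,5)`: `(z, L, vol, m, n) = (15, 10, 30, 11, 41)`, slack one.  The survivors of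
record `j = 29, 30` (cover+words-ALIVE in cases γ and β, seat stpp-2 gen 25's DATUM) die by the A-PAIRING of `W` (`STPPVosperSlackOnePairing.lean`): with
that premise the γ / α₂ / β tables keep only `j ∈ {4, 55}` (γ, β) and `j ∈ {4, 19, 20, 39, 40, 55}` (α₂, 24 admissible `(j, ℓ₁, δ)`), and every one of those
configurations has NO word-admissible placement of the single other block `(3,2,5)` against `Y°`, `Z°` (`existsCoverW` over `blockDiffsWQ`, Y-first,
≤ 4.5·10³ mirror steps each; python HOME `pub-omega-stpp-2-g26/code/survey_235.py`, `coverby_mirror.py`).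
Tables: `tableG59_41_11_3_P` (γ), `tableB59_42_11_3_P` (β, `tableBetaP`), `target_59_a2_b3`.  Nothing here is progress on `ω`.
-/

open Finset

namespace Summit.MatrixMultiplication.OmegaCensus.CubeNB

/-- Tight-type (case γ) window table `(n, m, b) = (41, 11, 3)` at `59` WITH THE PAIRING premise (`tableGammaP`, `a = 2`, fuel `30`): survivors
`4, 55` beyond the words (without the pairing: also `29, 30`). [folklore] -/
theorem tableG59_41_11_3_P : tableGammaP 59 41 11 3 2 30 ({0, 1, 58, 2, 57, 4, 55} : Finset ℕ) = true := by
  decide +kernel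

/-- Case-β table `(n+1, m, b) = (42, 11, 3)` at `59` WITH THE PAIRING conjunct (`tableBetaP`, `a = 2`, fuel `30`): survivors `4, 55` beyond the words
(without the pairing: also `29, 30`). [folklore] -/
theorem tableB59_42_11_3_P : tableBetaP 59 42 11 3 2 30 ({0, 1, 58, 2, 57, 4, 55} : Finset ℕ) = true := by
  decide +kernel

end Summit.MatrixMultiplication.OmegaCensus.CubeNB
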